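import Literature.Geometry.Lorentzian.KerrConvergence
import Literature.Geometry.Lorentzian.CauchyDevelopment
import HarnessLib

/-!
# Leaf-adapted late model charts along a Cauchy foliation (definition request
# `defn-LeafAdaptedModelCharts`, route FinalStateConjecture/LapseTrumpetKID)

The requester's words: *"`LeafAdaptedModelCharts (𝒟 : VacuumCauchyDevelopment D)
(F : ℝ × X → 𝒟.carrier) (n : ℕ) (U : Fin n → Opens E4) (γ : ∀ i, LorentzianMetric 𝓘(ℝ,E4) ∞ (U i))
(b) (ρ) (Φ : ∀ i, U i → 𝒟.carrier) (R) (U₀ : Opens E4) (Φ₀ : U₀ → 𝒟.carrier) (τ₀ : ℝ)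
(ξ : Fin n → ℝ → E3) (v : Fin n → E3) (ς : Fin n → ℝ → ℝ) : Prop` — b agrees with γ; late model
charts (`IsLateChart` of `ModelBackground.mk (U i) (b i) (fun x ↦ x 0) (ρ i)`); leaf-adapted
(`{x⁰ = t}` ↦ leaf `F({t} × X)`) with images in `J⁺(ιX)`; proper truncations; radii `R i → ∞` with
`truncDeviationCk` (`k = 2`) `→ 0` along them; pairwise disjoint truncated tubes eventually;
leaf-adapted flat chart (`Minkowski.backgroundOn U₀`) with `deviationCk → 0`; straight subluminal
tracks `ξ i = t v i + o(t)`, sublinear `ς i`; far-domain inclusion; exhaustion clause in the shape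
of `HasExhaustiveCharts` relative to `J⁺(ιX) ∩ I⁻(Φ₀(late))`. Purpose: the shared
conclusion/hypothesis of TrumpetLimits and SliceDictionary in route LapseTrumpetKID"* — i.e. the
chart / convergence / separation / far-zone / exhaustion clauses of the hypothesis of the route's
(typed) item `SliceDictionary`, VERBATIM, so that its informal layer-2 item `TrumpetLimits`
(5.6k chars inline, above the signature cap) can be typed and the glue
`TrumpetLimits → TrumpetKIDRigidity → SliceDictionary` stays literal.

## What it says

Data: a vacuum Cauchy development `𝒟 = (M, g, τ, ι, ν)` of `3`-dimensional data on `X`, a map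
`F : ℝ × X → M` (meant: a Cauchy foliation, leaf `t` = `F({t} × X)`), and `n` *model charts*:
open coordinate domains `Uᵢ ⊆ E4 = ℝ⁴` carrying `C^∞` Lorentzian metrics `γᵢ` (the limit
models — stationary trumpet models, Kerr exteriors, …; nothing about them is assumed here), their
coefficient families `bᵢ : E4 → (E4 →L E4 →L ℝ)` (total functions agreeing with `γᵢ` on `Uᵢ`, as
`ModelBackground.bilin` wants), truncation radius functions `ρᵢ`, chart maps `Φᵢ : Uᵢ → M`,
growing near-zone radii `Rᵢ : ℝ → ℝ`, a flat chart `Φ₀ : U₀ → M`, a common late time `τ₀`, and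
tracks `ξᵢ : ℝ → E3` with asymptotic velocities `vᵢ` and excision radii `ςᵢ`. The predicate is
the conjunction, in this order, of:

1. `bᵢ = γᵢ` on `Uᵢ` (the reference background `Bᵢ := (Uᵢ, bᵢ, t = x⁰, r = ρᵢ)` IS the model);
2. each `Φᵢ` is a late-time chart on `Bᵢ` after `τ₀` (`Spacetime.IsLateChart`: smooth, an open
   embedding of `{x⁰ > τ₀}`; region `univ`, the exterior region being fixed only downstream);
3. LEAF-ADAPTED: for `x⁰ > τ₀`, `Φᵢ x` lies in `J⁺(ι X)` and on the leaf `F({x⁰} × X)` — the model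
   time IS the foliation time;
4. PROPER TRUNCATIONS: every truncated model slab `{x⁰ = t, ρᵢ ≤ r}` is compact;
5. `Rᵢ(t) → ∞` and the `C²` truncated deviation `‖Φᵢ^* g − γᵢ‖_{C²({x⁰ = t, ρᵢ ≤ Rᵢ(t)})} → 0`;
6. SEPARATION: for every `r` the truncated tubes `Φᵢ({x⁰ > t₁, ρᵢ ≤ r})` are eventually pairwise
   disjoint;
7. `Φ₀` is a late-time chart on the flat background `(U₀, η, x⁰, |x̲|)` after `τ₀`,
8. leaf-adapted in the same sense, with
9. full `C²` deviation from `η` on the flat slabs `{x⁰ = t} ∩ U₀` tending to `0`;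
10. TRACKS: `|vᵢ| < 1`, `ςᵢ(t)/t → 0`, `|ξᵢ(t) − t vᵢ|/t → 0` (straight subluminal tracks up to
    `o(t)`, sublinear excision);
11. FAR DOMAIN: `U₀ ⊇ {(t, y) | τ₀ < t, ςᵢ(t) < |y − ξᵢ(t)| ∀ i}`;
12. EXHAUSTION (the shape of `Summit.FinalStateConjecture.HasExhaustiveCharts`, relative to
    `O := J⁺(ι X) ∩ I⁻(Φ₀({x⁰ > τ₀}))`): for every `t₁ > τ₀`, every point of `O` neither in
    `Φ₀({x⁰ > t₁})` nor in some `Φᵢ({x⁰ > t₁, ρᵢ ≤ Rᵢ(x⁰)})` lies in the causal past of the certified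
    slab `Φ₀({x⁰ = t₁}) ∪ ⋃ᵢ Φᵢ({x⁰ = t₁, ρᵢ ≤ Rᵢ(t₁)})`.

## Rendering and faithfulness

* The body is the text of clauses 2–13 of the hypothesis of `SliceDictionary`
  (`Summits/FinalStateConjecture/FinalStateConjecture/Theses/LapseTrumpetKID.lean`, rc 0), copied
  verbatim with the same binder names and types, so that `leafAdaptedModelCharts_iff` is `Iff.rfl`
  and a hypothesis `h : LeafAdaptedModelCharts …` closes the inline form by `exact h`. A plain `def`
  (not a `structure`) for exactly this reason; named projections are provided in
  `namespace LeafAdaptedModelCharts`.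
* Signature exactly as requested: `𝒟 : VacuumCauchyDevelopment D` (the vacuum equation plays no
  role in the clauses — only the underlying spacetime, `ι` and `F` are used — but every item of the
  route quantifies over `VacuumCauchyDevelopment`, and keeping the binder avoids `toCauchyDevelopment`
  coercions in the 4k-capped signatures); `C²` is fixed (`k = 2`), as in the summit statement
  (`FinalStateDecomposition 𝒟.toSpacetime O 2`).
* Nothing is asserted to EXIST and no property of the models `(Uᵢ, γᵢ)` (stationarity, vacuum,
  trumpet/Kerr structure) or of `F` (being a foliation) is part of the predicate: those are the
  separate definition requests `IsTrumpetModel` / `IsKerrEmbeddedStationary` /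
  `IsNormalisedMaximalFoliation` and are conjoined by the route items themselves.
* Sanity (proved below): the unfolding lemma; projections; charted late points lie in `J⁺(ι X)` and
  on leaves of `F` (`image_lateRegion_subset_causalFuture`, `image_lateRegion_subset_range`); with
  no model chart (`n = 0`) the far-domain clause forces `U₀ ⊇ {x⁰ > τ₀}` — the flat chart must cover
  whole late half-spaces, so the `C²`-flatness clause cannot be made vacuous by a small `U₀`
  (`lateRegion_subset_flatDomain_of_isEmpty`, cf. `FinalStateDecomposition.lateRegion_subset_flatDomain_of_N_eq_zero`).

## Sources

No printed formulation exists (as for `FinalStateDecomposition`): this is route-posited vocabulary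
assembled from the consequence-form convergence layer of `KerrConvergence.lean` — late-time charts
and `Cᵏ` deviations after Dafermos–Holzegel–Rodnianski–Taylor, arXiv:2104.08222, §1 and
Klainerman–Szeftel, PAMQ 19 (2023), Thm. 1.1 — adapted to the leaves of a (maximal) Cauchy time
function as in Christodoulou–Klainerman 1993 (Part III: the maximal foliation `{t = const}` of the
development), with the covering clause of the folklore `N`-black-hole final state picture
(Penrose 1982, Problem 12; Klainerman, *Brief history*, §4).

## References

* M. Dafermos, G. Holzegel, I. Rodnianski, M. Taylor, *The non-linear stability of the
  Schwarzschild family of black holes*, arXiv:2104.08222, §1. [arXiv210408222]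
* S. Klainerman, J. Szeftel, *Kerr stability for small angular momentum*, PAMQ 19 (2023), Thm. 1.1.
  [KlainermanSzeftel2023]
* D. Christodoulou, S. Klainerman, *The global nonlinear stability of the Minkowski space*,
  Princeton 1993, Part III (maximal foliation). [ChristodoulouKlainerman1993]
* R. Penrose, *Some unsolved problems in classical general relativity* (1982), Problem 12.
  [Penrose1982]
-/

noncomputable section

open TopologicalSpace Manifold Filter Topology Set Function
open scoped ContDiff Topology ENNReal

universe u

namespace Literature.Geometry.Lorentzian

variable {X : Type u} [TopologicalSpace X] [ChartedSpace E3 X] [IsManifold (𝓡 3) ∞ X]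
  [ConnectedSpace X] {D : InitialDataSet (𝓡 3) X}

/-- **Leaf-adapted late model charts** of the vacuum Cauchy development `𝒟 = (M, g, τ, ι, ν)`
along the map `F : ℝ × X → M` (meant: a Cauchy foliation with leaves `F({t} × X)`): `n` model
charts `Φᵢ : Uᵢ → M` from open domains `Uᵢ ⊆ ℝ⁴` carrying `C^∞` Lorentzian metrics `γᵢ` with
coefficient families `bᵢ = γᵢ` on `Uᵢ`, truncation radii `ρᵢ` and growing near-zone radii `Rᵢ`,
plus a flat chart `Φ₀ : U₀ → M`, such that, after the common time `τ₀`: every `Φᵢ` and `Φ₀` is a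
late-time chart (`Spacetime.IsLateChart`, model time `x⁰`) which is LEAF-ADAPTED — the model slab
`{x⁰ = t}` is mapped into the leaf `F({t} × X)` and into `J⁺(ι X)`; the truncated model slabs
`{x⁰ = t, ρᵢ ≤ r}` are compact; `Rᵢ(t) → ∞` and the `C²` deviation of `Φᵢ^* g` from `γᵢ` on
`{x⁰ = t, ρᵢ ≤ Rᵢ(t)}` tends to `0`; the truncated tubes are eventually pairwise disjoint for every
radius; the full `C²` deviation of `Φ₀^* g` from `η` on the flat slabs tends to `0`; the tracks are
straight and subluminal up to `o(t)` (`|vᵢ| < 1`, `|ξᵢ(t) − t vᵢ| = o(t)`) with sublinear excision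
radii `ςᵢ = o(t)`; `U₀` contains `{(t, y) | τ₀ < t, ςᵢ(t) < |y − ξᵢ(t)| ∀ i}`; and EXHAUSTION: for
every `t₁ > τ₀`, the part of `J⁺(ι X) ∩ I⁻(Φ₀({x⁰ > τ₀}))` outside
`Φ₀({x⁰ > t₁}) ∪ ⋃ᵢ Φᵢ({x⁰ > t₁, ρᵢ ≤ Rᵢ(x⁰)})` lies in `J⁻(Φ₀({x⁰ = t₁}) ∪ ⋃ᵢ Φᵢ({x⁰ = t₁, ρᵢ ≤ Rᵢ(t₁)}))`.
Verbatim the chart/convergence/separation/far-zone/exhaustion clauses of the hypothesis of route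
item `SliceDictionary` (LapseTrumpetKID); route-posited vocabulary over the consequence-form
convergence layer of DHRT arXiv:2104.08222, §1 (module docstring; no printed formulation).
[cite: arXiv210408222, §1] -/
def LeafAdaptedModelCharts (𝒟 : VacuumCauchyDevelopment D) (F : ℝ × X → 𝒟.carrier) (n : ℕ)
    (U : Fin n → Opens E4) (γ : ∀ i, LorentzianMetric 𝓘(ℝ, E4) ∞ (U i))
    (b : Fin n → E4 → E4 →L[ℝ] E4 →L[ℝ] ℝ) (ρ : Fin n → E4 → ℝ) (Φ : ∀ i, U i → 𝒟.carrier)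
    (R : Fin n → ℝ → ℝ) (U₀ : Opens E4) (Φ₀ : U₀ → 𝒟.carrier) (τ₀ : ℝ) (ξ : Fin n → ℝ → E3)
    (v : Fin n → E3) (ς : Fin n → ℝ → ℝ) : Prop :=
  (∀ i (x : U i), b i x = (γ i).val x) ∧
  (∀ i, 𝒟.toSpacetime.IsLateChart (ModelBackground.mk (U i) (b i) (fun x ↦ x 0) (ρ i)) univ τ₀
    (Φ i)) ∧
  (∀ i (x : U i), τ₀ < (x : E4) 0 →
    Φ i x ∈ 𝒟.metric.causalFuture 𝒟.timeOrientation (range 𝒟.embed) ∧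
      Φ i x ∈ range (fun y : X ↦ F ((x : E4) 0, y))) ∧
  (∀ i (r t : ℝ), IsCompact {x : U i | (x : E4) 0 = t ∧ ρ i x ≤ r}) ∧
  (∀ i, Tendsto (R i) atTop atTop ∧
    Tendsto (fun t ↦ 𝒟.toSpacetime.truncDeviationCk
      (ModelBackground.mk (U i) (b i) (fun x ↦ x 0) (ρ i)) (Φ i) 2 (R i t) t) atTop (𝓝 0)) ∧
  (∀ r : ℝ, ∃ t₁ : ℝ, Pairwise (onFun Disjoint fun i ↦
    Φ i '' (ModelBackground.mk (U i) (b i) (fun x ↦ x 0) (ρ i)).truncLateRegion t₁ r)) ∧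
  𝒟.toSpacetime.IsLateChart (Minkowski.backgroundOn U₀) univ τ₀ Φ₀ ∧
  (∀ x : U₀, τ₀ < (x : E4) 0 →
    Φ₀ x ∈ 𝒟.metric.causalFuture 𝒟.timeOrientation (range 𝒟.embed) ∧
      Φ₀ x ∈ range (fun y : X ↦ F ((x : E4) 0, y))) ∧
  Tendsto (fun t ↦ 𝒟.toSpacetime.deviationCk (Minkowski.backgroundOn U₀) Φ₀ 2 t) atTop (𝓝 0) ∧
  (∀ i, ‖v i‖ < 1 ∧ Tendsto (fun t ↦ ς i t / t) atTop (𝓝 0) ∧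
    Tendsto (fun t ↦ ‖ξ i t - t • v i‖ / t) atTop (𝓝 0)) ∧
  (∀ (t : ℝ) (y : E3), τ₀ < t → (∀ i, ς i t < ‖y - ξ i t‖) → E4.ofTimeSpace t y ∈ (U₀ : Set E4)) ∧
  (∀ t₁ : ℝ, τ₀ < t₁ →
    (𝒟.metric.causalFuture 𝒟.timeOrientation (range 𝒟.embed) ∩
        𝒟.metric.chronologicalPast 𝒟.timeOrientation
          (Φ₀ '' (Minkowski.backgroundOn U₀).lateRegion τ₀)) \
      (Φ₀ '' (Minkowski.backgroundOn U₀).lateRegion t₁ ∪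
        ⋃ i, Φ i '' {x : U i | t₁ < (x : E4) 0 ∧ ρ i x ≤ R i ((x : E4) 0)}) ⊆
    𝒟.metric.causalPast 𝒟.timeOrientation
      (Φ₀ '' (Minkowski.backgroundOn U₀).timeSlab t₁ ∪
        ⋃ i, Φ i '' (ModelBackground.mk (U i) (b i) (fun x ↦ x 0) (ρ i)).truncTimeSlab
          (R i t₁) t₁))

/-- Unfolding lemma: `LeafAdaptedModelCharts` is, by `Iff.rfl`, the verbatim conjunction of the
chart / convergence / separation / far-zone / exhaustion clauses of the hypothesis of route item
`SliceDictionary` (so the inline forms of the route restate definitionally). DHRT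
arXiv:2104.08222, §1 (consequence-form convergence). [cite: arXiv210408222, §1] -/
theorem leafAdaptedModelCharts_iff (𝒟 : VacuumCauchyDevelopment D) (F : ℝ × X → 𝒟.carrier)
    (n : ℕ) (U : Fin n → Opens E4) (γ : ∀ i, LorentzianMetric 𝓘(ℝ, E4) ∞ (U i))
    (b : Fin n → E4 → E4 →L[ℝ] E4 →L[ℝ] ℝ) (ρ : Fin n → E4 → ℝ) (Φ : ∀ i, U i → 𝒟.carrier)
    (R : Fin n → ℝ → ℝ) (U₀ : Opens E4) (Φ₀ : U₀ → 𝒟.carrier) (τ₀ : ℝ) (ξ : Fin n → ℝ → E3)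
    (v : Fin n → E3) (ς : Fin n → ℝ → ℝ) :
    LeafAdaptedModelCharts 𝒟 F n U γ b ρ Φ R U₀ Φ₀ τ₀ ξ v ς ↔
      (∀ i (x : U i), b i x = (γ i).val x) ∧
      (∀ i, 𝒟.toSpacetime.IsLateChart (ModelBackground.mk (U i) (b i) (fun x ↦ x 0) (ρ i))
        univ τ₀ (Φ i)) ∧
      (∀ i (x : U i), τ₀ < (x : E4) 0 →
        Φ i x ∈ 𝒟.metric.causalFuture 𝒟.timeOrientation (range 𝒟.embed) ∧
          Φ i x ∈ range (fun y : X ↦ F ((x : E4) 0, y))) ∧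
      (∀ i (r t : ℝ), IsCompact {x : U i | (x : E4) 0 = t ∧ ρ i x ≤ r}) ∧
      (∀ i, Tendsto (R i) atTop atTop ∧
        Tendsto (fun t ↦ 𝒟.toSpacetime.truncDeviationCk
          (ModelBackground.mk (U i) (b i) (fun x ↦ x 0) (ρ i)) (Φ i) 2 (R i t) t)
          atTop (𝓝 0)) ∧
      (∀ r : ℝ, ∃ t₁ : ℝ, Pairwise (onFun Disjoint fun i ↦
        Φ i '' (ModelBackground.mk (U i) (b i) (fun x ↦ x 0) (ρ i)).truncLateRegion t₁ r)) ∧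
      𝒟.toSpacetime.IsLateChart (Minkowski.backgroundOn U₀) univ τ₀ Φ₀ ∧
      (∀ x : U₀, τ₀ < (x : E4) 0 →
        Φ₀ x ∈ 𝒟.metric.causalFuture 𝒟.timeOrientation (range 𝒟.embed) ∧
          Φ₀ x ∈ range (fun y : X ↦ F ((x : E4) 0, y))) ∧
      Tendsto (fun t ↦ 𝒟.toSpacetime.deviationCk (Minkowski.backgroundOn U₀) Φ₀ 2 t)
        atTop (𝓝 0) ∧
      (∀ i, ‖v i‖ < 1 ∧ Tendsto (fun t ↦ ς i t / t) atTop (𝓝 0) ∧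
        Tendsto (fun t ↦ ‖ξ i t - t • v i‖ / t) atTop (𝓝 0)) ∧
      (∀ (t : ℝ) (y : E3), τ₀ < t → (∀ i, ς i t < ‖y - ξ i t‖) →
        E4.ofTimeSpace t y ∈ (U₀ : Set E4)) ∧
      (∀ t₁ : ℝ, τ₀ < t₁ →
        (𝒟.metric.causalFuture 𝒟.timeOrientation (range 𝒟.embed) ∩
            𝒟.metric.chronologicalPast 𝒟.timeOrientation
              (Φ₀ '' (Minkowski.backgroundOn U₀).lateRegion τ₀)) \
          (Φ₀ '' (Minkowski.backgroundOn U₀).lateRegion t₁ ∪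
            ⋃ i, Φ i '' {x : U i | t₁ < (x : E4) 0 ∧ ρ i x ≤ R i ((x : E4) 0)}) ⊆
        𝒟.metric.causalPast 𝒟.timeOrientation
          (Φ₀ '' (Minkowski.backgroundOn U₀).timeSlab t₁ ∪
            ⋃ i, Φ i '' (ModelBackground.mk (U i) (b i) (fun x ↦ x 0) (ρ i)).truncTimeSlab
              (R i t₁) t₁)) :=
  Iff.rfl

namespace LeafAdaptedModelCharts

variable {𝒟 : VacuumCauchyDevelopment D} {F : ℝ × X → 𝒟.carrier} {n : ℕ} {U : Fin n → Opens E4}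
  {γ : ∀ i, LorentzianMetric 𝓘(ℝ, E4) ∞ (U i)} {b : Fin n → E4 → E4 →L[ℝ] E4 →L[ℝ] ℝ}
  {ρ : Fin n → E4 → ℝ} {Φ : ∀ i, U i → 𝒟.carrier} {R : Fin n → ℝ → ℝ} {U₀ : Opens E4}
  {Φ₀ : U₀ → 𝒟.carrier} {τ₀ : ℝ} {ξ : Fin n → ℝ → E3} {v : Fin n → E3} {ς : Fin n → ℝ → ℝ}

/-- The coefficient family `bᵢ` agrees with the model metric `γᵢ` on `Uᵢ` (clause 1).
DHRT arXiv:2104.08222, §1. [cite: arXiv210408222, §1] -/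
theorem bilin_eq (h : LeafAdaptedModelCharts 𝒟 F n U γ b ρ Φ R U₀ Φ₀ τ₀ ξ v ς) (i : Fin n)
    (x : U i) : b i x = (γ i).val x :=
  h.1 i x

/-- Each model chart `Φᵢ` is a late-time chart on `(Uᵢ, bᵢ, x⁰, ρᵢ)` after `τ₀` (clause 2).
DHRT arXiv:2104.08222, §1. [cite: arXiv210408222, §1] -/
theorem isLateChart (h : LeafAdaptedModelCharts 𝒟 F n U γ b ρ Φ R U₀ Φ₀ τ₀ ξ v ς) (i : Fin n) :
    𝒟.toSpacetime.IsLateChart (ModelBackground.mk (U i) (b i) (fun x ↦ x 0) (ρ i)) univ τ₀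
      (Φ i) :=
  h.2.1 i

/-- Late charted points lie in the causal future of the initial slice `ι(X)` (clause 3, first
half). DHRT arXiv:2104.08222, §1. [cite: arXiv210408222, §1] -/
theorem mem_causalFuture (h : LeafAdaptedModelCharts 𝒟 F n U γ b ρ Φ R U₀ Φ₀ τ₀ ξ v ς)
    (i : Fin n) {x : U i} (hx : τ₀ < (x : E4) 0) :
    Φ i x ∈ 𝒟.metric.causalFuture 𝒟.timeOrientation (range 𝒟.embed) :=
  (h.2.2.1 i x hx).1

/-- LEAF-ADAPTED: the late charted point `Φᵢ x` lies on the leaf `F({x⁰} × X)` (clause 3, second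
half). Christodoulou–Klainerman 1993, Part III (leaves of the time function).
[cite: ChristodoulouKlainerman1993, Part III] -/
theorem mem_range_leaf (h : LeafAdaptedModelCharts 𝒟 F n U γ b ρ Φ R U₀ Φ₀ τ₀ ξ v ς)
    (i : Fin n) {x : U i} (hx : τ₀ < (x : E4) 0) :
    Φ i x ∈ range (fun y : X ↦ F ((x : E4) 0, y)) :=
  (h.2.2.1 i x hx).2

/-- PROPER TRUNCATIONS: the truncated model slabs `{x⁰ = t, ρᵢ ≤ r}` are compact (clause 4).
DHRT arXiv:2104.08222, §1 (near zones `{r ≤ R}`). [cite: arXiv210408222, §1] -/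
theorem isCompact_truncSlab (h : LeafAdaptedModelCharts 𝒟 F n U γ b ρ Φ R U₀ Φ₀ τ₀ ξ v ς)
    (i : Fin n) (r t : ℝ) : IsCompact {x : U i | (x : E4) 0 = t ∧ ρ i x ≤ r} :=
  h.2.2.2.1 i r t

/-- The near-zone radii grow without bound, `Rᵢ(t) → ∞` (clause 5, first half).
DHRT arXiv:2104.08222, §1. [cite: arXiv210408222, §1] -/
theorem tendsto_radius (h : LeafAdaptedModelCharts 𝒟 F n U γ b ρ Φ R U₀ Φ₀ τ₀ ξ v ς)
    (i : Fin n) : Tendsto (R i) atTop atTop :=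
  (h.2.2.2.2.1 i).1

/-- Near-zone `C²` convergence to the model along the growing radii:
`‖Φᵢ^* g − γᵢ‖_{C²({x⁰ = t, ρᵢ ≤ Rᵢ(t)})} → 0` (clause 5, second half). DHRT arXiv:2104.08222,
§1. [cite: arXiv210408222, §1] -/
theorem tendsto_truncDeviationCk (h : LeafAdaptedModelCharts 𝒟 F n U γ b ρ Φ R U₀ Φ₀ τ₀ ξ v ς)
    (i : Fin n) :
    Tendsto (fun t ↦ 𝒟.toSpacetime.truncDeviationCk
      (ModelBackground.mk (U i) (b i) (fun x ↦ x 0) (ρ i)) (Φ i) 2 (R i t) t) atTop (𝓝 0) :=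
  (h.2.2.2.2.1 i).2

/-- Near-zone `C²` convergence on every FIXED truncation radius `r` (from clause 5 and
monotonicity of the truncated deviation in the radius, since `Rᵢ(t) ≥ r` eventually).
DHRT arXiv:2104.08222, §1. [cite: arXiv210408222, §1] -/
theorem tendsto_truncDeviationCk_const
    (h : LeafAdaptedModelCharts 𝒟 F n U γ b ρ Φ R U₀ Φ₀ τ₀ ξ v ς) (i : Fin n) (r : ℝ) :
    Tendsto (fun t ↦ 𝒟.toSpacetime.truncDeviationCk
      (ModelBackground.mk (U i) (b i) (fun x ↦ x 0) (ρ i)) (Φ i) 2 r t) atTop (𝓝 0) := by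
  have hR : ∀ᶠ t in atTop, r ≤ R i t := (h.tendsto_radius i).eventually_ge_atTop r
  have hle : ∀ᶠ t in atTop,
      𝒟.toSpacetime.truncDeviationCk (ModelBackground.mk (U i) (b i) (fun x ↦ x 0) (ρ i))
          (Φ i) 2 r t ≤
        𝒟.toSpacetime.truncDeviationCk (ModelBackground.mk (U i) (b i) (fun x ↦ x 0) (ρ i))
          (Φ i) 2 (R i t) t :=
    hR.mono fun t ht ↦ Spacetime.truncDeviationCk_mono 𝒟.toSpacetime
      (ModelBackground.mk (U i) (b i) (fun x ↦ x 0) (ρ i)) (Φ i) 2 ht t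
  exact tendsto_of_tendsto_of_tendsto_of_le_of_le' tendsto_const_nhds
    (h.tendsto_truncDeviationCk i) (Eventually.of_forall fun _ ↦ zero_le) hle

/-- SEPARATION: for every radius `r` the truncated tubes `Φᵢ({x⁰ > t₁, ρᵢ ≤ r})` are pairwise
disjoint for some `t₁` (clause 6). Folklore `N`-body final state picture (Penrose 1982,
Problem 12; Klainerman, §4: "moving away from each other"). [cite: Penrose1982, Problem 12] -/
theorem exists_pairwise_disjoint (h : LeafAdaptedModelCharts 𝒟 F n U γ b ρ Φ R U₀ Φ₀ τ₀ ξ v ς)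
    (r : ℝ) : ∃ t₁ : ℝ, Pairwise (onFun Disjoint fun i ↦
      Φ i '' (ModelBackground.mk (U i) (b i) (fun x ↦ x 0) (ρ i)).truncLateRegion t₁ r) :=
  h.2.2.2.2.2.1 r

/-- The flat chart `Φ₀` is a late-time chart on `(U₀, η, x⁰, |x̲|)` after `τ₀` (clause 7).
Christodoulou–Klainerman 1993, Thm. 1.0.2 (consequence form). [cite: ChristodoulouKlainerman1993, Thm. 1.0.2] -/
theorem isLateChart_flat (h : LeafAdaptedModelCharts 𝒟 F n U γ b ρ Φ R U₀ Φ₀ τ₀ ξ v ς) :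
    𝒟.toSpacetime.IsLateChart (Minkowski.backgroundOn U₀) univ τ₀ Φ₀ :=
  h.2.2.2.2.2.2.1

/-- Late points of the flat chart lie in `J⁺(ι X)` (clause 8, first half).
Christodoulou–Klainerman 1993, Thm. 1.0.2. [cite: ChristodoulouKlainerman1993, Thm. 1.0.2] -/
theorem mem_causalFuture_flat (h : LeafAdaptedModelCharts 𝒟 F n U γ b ρ Φ R U₀ Φ₀ τ₀ ξ v ς)
    {x : U₀} (hx : τ₀ < (x : E4) 0) :
    Φ₀ x ∈ 𝒟.metric.causalFuture 𝒟.timeOrientation (range 𝒟.embed) :=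
  (h.2.2.2.2.2.2.2.1 x hx).1

/-- LEAF-ADAPTED flat chart: `Φ₀ x` lies on the leaf `F({x⁰} × X)` (clause 8, second half).
Christodoulou–Klainerman 1993, Part III. [cite: ChristodoulouKlainerman1993, Part III] -/
theorem mem_range_leaf_flat (h : LeafAdaptedModelCharts 𝒟 F n U γ b ρ Φ R U₀ Φ₀ τ₀ ξ v ς)
    {x : U₀} (hx : τ₀ < (x : E4) 0) :
    Φ₀ x ∈ range (fun y : X ↦ F ((x : E4) 0, y)) :=
  (h.2.2.2.2.2.2.2.1 x hx).2

/-- Radiation zone: the full `C²` deviation of `Φ₀^* g` from `η` on the flat slabs tends to `0`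
(clause 9). Christodoulou–Klainerman 1993, Thm. 1.0.2 (consequence form). [cite: ChristodoulouKlainerman1993, Thm. 1.0.2] -/
theorem tendsto_deviationCk_flat (h : LeafAdaptedModelCharts 𝒟 F n U γ b ρ Φ R U₀ Φ₀ τ₀ ξ v ς) :
    Tendsto (fun t ↦ 𝒟.toSpacetime.deviationCk (Minkowski.backgroundOn U₀) Φ₀ 2 t)
      atTop (𝓝 0) :=
  h.2.2.2.2.2.2.2.2.1

/-- The asymptotic velocities are subluminal, `|vᵢ| < 1` (clause 10). Folklore final state
picture (Penrose 1982, Problem 12). [cite: Penrose1982, Problem 12] -/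
theorem norm_velocity_lt_one (h : LeafAdaptedModelCharts 𝒟 F n U γ b ρ Φ R U₀ Φ₀ τ₀ ξ v ς)
    (i : Fin n) : ‖v i‖ < 1 :=
  (h.2.2.2.2.2.2.2.2.2.1 i).1

/-- The excision radii are sublinear, `ςᵢ(t)/t → 0` (clause 10). Folklore final state picture
(Penrose 1982, Problem 12). [cite: Penrose1982, Problem 12] -/
theorem tendsto_excision_div (h : LeafAdaptedModelCharts 𝒟 F n U γ b ρ Φ R U₀ Φ₀ τ₀ ξ v ς)
    (i : Fin n) : Tendsto (fun t ↦ ς i t / t) atTop (𝓝 0) :=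
  (h.2.2.2.2.2.2.2.2.2.1 i).2.1

/-- The tracks are straight up to `o(t)`: `|ξᵢ(t) − t vᵢ|/t → 0` (clause 10). Folklore final
state picture (Penrose 1982, Problem 12). [cite: Penrose1982, Problem 12] -/
theorem tendsto_track_sub_div (h : LeafAdaptedModelCharts 𝒟 F n U γ b ρ Φ R U₀ Φ₀ τ₀ ξ v ς)
    (i : Fin n) : Tendsto (fun t ↦ ‖ξ i t - t • v i‖ / t) atTop (𝓝 0) :=
  (h.2.2.2.2.2.2.2.2.2.1 i).2.2

/-- FAR DOMAIN: `U₀` contains every late point outside all excision balls around the tracks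
(clause 11). Folklore final state picture (Penrose 1982, Problem 12). [cite: Penrose1982, Problem 12] -/
theorem ofTimeSpace_mem_flatDomain (h : LeafAdaptedModelCharts 𝒟 F n U γ b ρ Φ R U₀ Φ₀ τ₀ ξ v ς)
    {t : ℝ} {y : E3} (ht : τ₀ < t) (hy : ∀ i, ς i t < ‖y - ξ i t‖) :
    E4.ofTimeSpace t y ∈ (U₀ : Set E4) :=
  h.2.2.2.2.2.2.2.2.2.2.1 t y ht hy

/-- EXHAUSTION (clause 12, the shape of `HasExhaustiveCharts` relative to
`J⁺(ι X) ∩ I⁻(Φ₀({x⁰ > τ₀}))`). DHRT arXiv:2104.08222, §1 (the charts cover the exterior up to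
the horizon). [cite: arXiv210408222, §1] -/
theorem exhaustion (h : LeafAdaptedModelCharts 𝒟 F n U γ b ρ Φ R U₀ Φ₀ τ₀ ξ v ς) {t₁ : ℝ}
    (ht₁ : τ₀ < t₁) :
    (𝒟.metric.causalFuture 𝒟.timeOrientation (range 𝒟.embed) ∩
        𝒟.metric.chronologicalPast 𝒟.timeOrientation
          (Φ₀ '' (Minkowski.backgroundOn U₀).lateRegion τ₀)) \
      (Φ₀ '' (Minkowski.backgroundOn U₀).lateRegion t₁ ∪
        ⋃ i, Φ i '' {x : U i | t₁ < (x : E4) 0 ∧ ρ i x ≤ R i ((x : E4) 0)}) ⊆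
    𝒟.metric.causalPast 𝒟.timeOrientation
      (Φ₀ '' (Minkowski.backgroundOn U₀).timeSlab t₁ ∪
        ⋃ i, Φ i '' (ModelBackground.mk (U i) (b i) (fun x ↦ x 0) (ρ i)).truncTimeSlab
          (R i t₁) t₁) :=
  h.2.2.2.2.2.2.2.2.2.2.2 t₁ ht₁

/-- The late image of every model chart lies in `J⁺(ι X)` (from clause 3).
DHRT arXiv:2104.08222, §1. [cite: arXiv210408222, §1] -/
theorem image_lateRegion_subset_causalFuture
    (h : LeafAdaptedModelCharts 𝒟 F n U γ b ρ Φ R U₀ Φ₀ τ₀ ξ v ς) (i : Fin n) :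
    Φ i '' (ModelBackground.mk (U i) (b i) (fun x ↦ x 0) (ρ i)).lateRegion τ₀ ⊆
      𝒟.metric.causalFuture 𝒟.timeOrientation (range 𝒟.embed) := by
  rintro _ ⟨x, hx, rfl⟩
  exact h.mem_causalFuture i hx

/-- The late image of every model chart lies on leaves of `F`, in particular in `range F` (from
clause 3). Christodoulou–Klainerman 1993, Part III. [cite: ChristodoulouKlainerman1993, Part III] -/
theorem image_lateRegion_subset_range
    (h : LeafAdaptedModelCharts 𝒟 F n U γ b ρ Φ R U₀ Φ₀ τ₀ ξ v ς) (i : Fin n) :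
    Φ i '' (ModelBackground.mk (U i) (b i) (fun x ↦ x 0) (ρ i)).lateRegion τ₀ ⊆ range F := by
  rintro _ ⟨x, hx, rfl⟩
  obtain ⟨y, hy⟩ := h.mem_range_leaf i hx
  exact ⟨((x : E4) 0, y), hy⟩

/-- The late image of the flat chart lies in `J⁺(ι X)` (from clause 8).
Christodoulou–Klainerman 1993, Thm. 1.0.2. [cite: ChristodoulouKlainerman1993, Thm. 1.0.2] -/
theorem image_lateRegion_flat_subset_causalFuture
    (h : LeafAdaptedModelCharts 𝒟 F n U γ b ρ Φ R U₀ Φ₀ τ₀ ξ v ς) :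
    Φ₀ '' (Minkowski.backgroundOn U₀).lateRegion τ₀ ⊆
      𝒟.metric.causalFuture 𝒟.timeOrientation (range 𝒟.embed) := by
  rintro _ ⟨x, hx, rfl⟩
  exact h.mem_causalFuture_flat hx

/-- The late image of the flat chart lies on leaves of `F` (from clause 8).
Christodoulou–Klainerman 1993, Part III. [cite: ChristodoulouKlainerman1993, Part III] -/
theorem image_lateRegion_flat_subset_range
    (h : LeafAdaptedModelCharts 𝒟 F n U γ b ρ Φ R U₀ Φ₀ τ₀ ξ v ς) :
    Φ₀ '' (Minkowski.backgroundOn U₀).lateRegion τ₀ ⊆ range F := by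
  rintro _ ⟨x, hx, rfl⟩
  obtain ⟨y, hy⟩ := h.mem_range_leaf_flat hx
  exact ⟨((x : E4) 0, y), hy⟩

/-- Anti-vacuity of the far-domain clause: with NO model chart (`Fin n` empty) the flat domain
contains the whole late half-space `{x⁰ > τ₀}`, so the flat slabs are entire `{x⁰ = t}` and the
`C²`-flatness clause is the honest one (cf. `FinalStateDecomposition.lateRegion_subset_flatDomain_of_N_eq_zero`).
Christodoulou–Klainerman 1993, Thm. 1.0.2. [cite: ChristodoulouKlainerman1993, Thm. 1.0.2] -/
theorem lateRegion_subset_flatDomain_of_isEmpty [IsEmpty (Fin n)]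
    (h : LeafAdaptedModelCharts 𝒟 F n U γ b ρ Φ R U₀ Φ₀ τ₀ ξ v ς) :
    Minkowski.lateRegion τ₀ ⊆ (U₀ : Set E4) := by
  intro x hx
  have := h.ofTimeSpace_mem_flatDomain (t := E4.time x) (y := E4.spatial x) hx
    (fun i ↦ isEmptyElim i)
  rwa [E4.ofTimeSpace_time_spatial] at this

end LeafAdaptedModelCharts

end Literature.Geometry.Lorentzian

end
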